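import Literature.NumberTheory.EllipticCurves.GrossZagierRationalPointProofs
import HarnessLib

/-!
# Gross–Zagier 1986, Thm. I.(7.3) with the constant made EXPLICIT:
# `L'(E,1) · (2·c·u²·S⁻·k) = Ω(E) · ĥ(P_K + P̄_K)`

Proofs-only sequel (theorems only: no definition, no named fact; D-0026) of
`GrossZagierRationalPointProofs.lean`, where `GrossZagier1986_thm_I_7_3` (`L'(E,1) = α·Ω·ĥ(P)` with SOME
`α ∈ ℚ^×`) is derived from Modularity, Hoffstein–Luo and the Gross–Zagier formula over `K`. The
descent used there ("Path B" of GZ86 V.§2, pp. 312–313) in fact computes `α`; this file records the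
closed form, with every factor an explicitly computable invariant in the tree's normalisations — the
shape of GZ86 V.(2.2)–(2.3) (the comparison of `#Ш` with the square of the index of the Heegner
point), at the level of `L'(E,1)` and for ANY parametrisation datum:

for `W/ℚ` globally minimal with `L(E,1) = 0` and `w(E) = −1`, an imaginary quadratic `K` with ODD
discriminant `d = d_K` satisfying the Heegner hypothesis for `N_E`, a parametrisation datum
`Dt = (f, Λ_E, φ, c)`, a Heegner point `P_K ∈ E(K)` for it, the reflection `σ` of `K`, and the point
`P ∈ E(ℚ)` with `ι P = P_K + σ P_K` (it exists: `σP_K − P_K` is torsion, Darmon Prop. 3.11),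

  `L'(E,1) · (2 · c · u² · S⁻ · k) = Ω(W) · ĥ_ℚ(P)`      (`deriv_entireLFunction_one_mul_eq_of_heegnerPoint`)

where `u = #𝓞_K^×/2`, `S⁻ = ∑_{a mod |d|} (a/|d|)·[a/|d|]⁻_f ∈ ℚ` is the twisted minus modular-symbol
sum of `f` (`[r]⁻_f = ratMinusSymbol f r`, normalised by `Ω⁻_f = minusPeriod f`, `im Λ_f = ℤΩ⁻_f/2`),
and `k = c·Ω⁻_f/|Ω⁻(W)|` is the minus period ratio — an INTEGER `≠ 0`
(`ModularParametrizationData.exists_int_maninConstant_mul_minusPeriod_eq`). Both sides vanish when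
`L(E^{(d)},1) = 0`; when `L(E^{(d)},1) ≠ 0` (Waldspurger / Hoffstein–Luo) `S⁻ ≠ 0` and the identity
IS Thm. I.(7.3) with `α = 1/(2cu²S⁻k)` (`deriv_entireLFunction_one_eq_div_of_heegnerPoint`).
Ingredients, all theorems of the tree: the product rule `L'(E/K,1) = L'(E,1)L(E^{(d)},1)`, the
Gross–Zagier statement shape `GrossZagierFormula` (hypothesis `hGZF`, concluded by the named fact
`gross_zagier`), `‖ω‖² = 2covol(Λ_E) = Ω|Ω⁻|` (Cremona §3.7), Birch's formula for the odd character
`(·/|d|)` with Gauss's sign (`sqrt_mul_entireLFunction_quadraticTwist_one_eq_symbolSum_mul_minusPeriod`,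
the explicit form of `exists_rat_sqrt_mul_entireLFunction_quadraticTwist_one_eq`), Darmon's Prop. 3.11
(`heegnerPoint_conj_add_rootNumber_smul_holds`) and `ĥ_K ∘ ι = 2ĥ_ℚ` (Silverman VIII.5.4(b)).

Use (BSD cell `bsd-f1-sign2`, crux `RankOneAtTwoBigImageOddLocal`, line fkl, stubs (5a)/(5b)): with
`Ш_an = L'(E,1)·#T²/(Ω·∏c_ℓ·Reg)` and `ĥ(P) = n²·Reg` in rank one
(`exists_int_canonicalHeight_eq_sq_mul_regulator`) this reads `Ш_an = n²·#T²/(2cu²S⁻k·∏c_ℓ)`, so on a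
slice with `#T`, `∏c_ℓ`, `c` odd and `u = 1`: `ord₂ Ш_an = 2·ord₂ n − 1 − ord₂ S⁻ − ord₂ k` — the `2`-adic
content of the analytic side made exact and computable (nothing about `#Ш` is claimed here).

References: [GrossZagier1986] Thm. I.(7.3) p. 231, Thm. V.(2.1) p. 311, V.(2.2)–(2.3) and V.§2
pp. 312–313; [MazurTateTeitelbaum1986Invent] §I.8 (8.6); [Darmon2004] Prop. 3.11; [CremonaAlgorithms1997]
§2.8, §3.7; [SilvermanAEC2009] VIII.5.4(b), VIII.9.3.
-/

noncomputable section

open scoped Classical MatrixGroups ModularForm NumberTheorySymbols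

open Complex CongruenceSubgroup WeierstrassCurve NumberField

namespace Literature.NumberTheory.EllipticCurves

open ModularForms QuadraticFields WeierstrassCurve.Affine.Point WeierstrassCurve.QuadraticDescent

/-! ### The twisted central value with the explicit symbol sum -/

/-- **Birch's formula, explicit rational sum**: for `W/ℚ` elliptic with newform `f`, `d < 0`
square-free, `d ≡ 1 (mod 4)`, `(d, N_W) = 1`:
`√|d| · L(W^{(d)}, 1) = (∑_{a mod |d|} (a/|d|)·[a/|d|]⁻_f) · Ω⁻_f`, the sum being a rational number
(cast to `ℂ`). Explicit form of `exists_rat_sqrt_mul_entireLFunction_quadraticTwist_one_eq`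
(Mazur–Tate–Teitelbaum (8.6) for the odd character `(·/|d|)`, Gauss's sign, `aₙ(W^{(d)}) = (n/|d|)aₙ`).
[cite: MazurTateTeitelbaum1986Invent, Ch. I §8 (8.6)] [cite: GrossZagier1986, V.§2 (p. 312)] -/
theorem sqrt_mul_entireLFunction_quadraticTwist_one_eq_symbolSum_mul_minusPeriod
    (hE : hasEntireLFunction_rat) (W : WeierstrassCurve ℚ) [W.IsElliptic] {N : ℕ} [NeZero N]
    {f : CuspForm (Gamma0 N) 2} (hf : IsNewformOf W f) {d : ℤ} (hd0 : d < 0) (hsq : Squarefree d)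
    (hd4 : d % 4 = 1) (hgcd : Int.gcd d (W.conductorNorm ℤ) = 1) [NeZero d.natAbs] :
    (Real.sqrt |(d : ℝ)| : ℂ) * (W.quadraticTwist (d : ℚ)).entireLFunction 1 =
      ((∑ a : ZMod d.natAbs, (J((a.val : ℤ) | d.natAbs) : ℚ) *
          ratMinusSymbol f ((a.val : ℚ) / d.natAbs) : ℚ) : ℂ) * (minusPeriod f : ℂ) := by
  set D : ℕ := d.natAbs with hDdef
  have hDd : (D : ℤ) = -d := by rw [hDdef]; omega
  have hD3 : D % 4 = 3 := by omega
  have hDsq : Squarefree D := Int.squarefree_natAbs.mpr hsq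
  have hdq : (d : ℚ) ≠ 0 := by exact_mod_cast hsq.ne_zero
  haveI := W.isElliptic_quadraticTwist hdq
  have hEt : (W.quadraticTwist (d : ℚ)).HasEntireLFunction := hE _
  have hco : ∀ n : ℕ, (((W.quadraticTwist (d : ℚ)).LFunction n : ℤ) : ℂ) =
      jacobiChar D n * cuspCoeff f n := fun n ↦ by
    rw [LFunction_quadraticTwist_apply_of_int_gcd_eq_one W hd4 hsq hgcd n, Int.cast_mul,
      jacobiChar_natCast, hf.2 n]
  have hL' : ∀ s : ℂ, 2 < s.re →
      (W.quadraticTwist (d : ℚ)).entireLFunction s = twistedLSeries f (jacobiChar D) s := by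
    intro s hs
    rw [(W.quadraticTwist (d : ℚ)).entireLFunction_eq_LSeries hEt (by linarith)]
    unfold WeierstrassCurve.LSeries twistedLSeries
    congr 1
    funext n
    exact hco n
  have hB := ratMinusTwistedSymbolSum_jacobiChar_mul_minusPeriod hf.1 hf.coeffField_eq_bot hDsq hD3
    ((W.quadraticTwist (d : ℚ)).differentiable_entireLFunction hEt) hL'
  have hsqrt : Real.sqrt (D : ℝ) = Real.sqrt |(d : ℝ)| := by
    congr 1
    rw [hDdef, Nat.cast_natAbs, Int.cast_abs]
  rw [← hsqrt, ← hB, ratMinusTwistedSymbolSum]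
  push_cast
  congr 1

/-! ### The height of the descended point, for a GIVEN point -/

/-- **`ĥ_ℚ(P) = 2·ĥ_K(P_K)` for `ι P = P_K + σP_K` with `σP_K − P_K` torsion** (GZ86 V.§2 p. 313;
Silverman VIII.5.4(b): `ĥ_K ∘ ι = [K:ℚ]·ĥ_ℚ`; `ĥ_K(2P_K + T) = 4ĥ_K(P_K)`). The given-point form of
`exists_point_canonicalHeight_eq_two_mul`. [cite: GrossZagier1986, V.§2 (p. 313)]
[cite: SilvermanAEC2009, Prop. VIII.5.4(b)] -/
theorem canonicalHeight_eq_two_mul_of_incl_eq (W : WeierstrassCurve ℚ) [W.IsElliptic]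
    {K : Type*} [Field K] [NumberField K] (h2 : Module.finrank ℚ K = 2) (σ : K →ₐ[ℚ] K)
    {P : (W.baseChange K).toAffine.Point} (hT : IsOfFinAddOrder (conjMap W σ P - P))
    {R : W.toAffine.Point} (hR : incl K W R = P + conjMap W σ P) :
    canonicalHeight R = 2 * canonicalHeight P := by
  haveI : (W.baseChange K).IsElliptic := by rw [WeierstrassCurve.baseChange]; infer_instance
  have hQ' : P + conjMap W σ P = (2 : ℕ) • P + (conjMap W σ P - P) := by rw [two_nsmul]; abel
  have hhQ : canonicalHeight (P + conjMap W σ P) = 4 * canonicalHeight P := by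
    rw [hQ', canonicalHeight_add_of_isOfFinAddOrder _ hT, canonicalHeight_nsmul_holds]
    norm_num
  have hhR : canonicalHeight (incl K W R) = 2 * canonicalHeight R := by
    have h := canonicalHeight_baseChange (W := W) (K := ℚ) (L := K) R
    rw [h2] at h
    convert h using 2 <;> rfl
  have : 2 * canonicalHeight R = 4 * canonicalHeight P := by rw [← hhR, hR, hhQ]
  linarith

/-! ### The explicit identity -/

/-- **Gross–Zagier 1986, Thm. I.(7.3) with explicit constant (GZ86 V.§2 / V.(2.2) shape).** Let
`W/ℚ` be globally minimal elliptic with `L(E,1) = 0` and `w(E) = −1`; `K` imaginary quadratic with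
odd discriminant `d = d_K`, satisfying the Heegner hypothesis for `N_E`; `Dt = (f, Λ_E, φ, c)` a
parametrisation datum, `H` a Heegner datum, `ι : K → ℂ`, and `P_K ∈ E(K)` the corresponding Heegner
point (`ι P_K = ∑ φ(τ_Q)`); assume the Gross–Zagier formula for `(N_E, W, K)` (`hGZF`, the statement
shape concluded by the named fact `gross_zagier`) and the entire continuation of the `L`-functions
(`hE`, modularity). Then for the reflection `σ ≠ id` of `K` and any `P ∈ E(ℚ)` with
`ι P = P_K + σP_K`:

  `L'(E,1) · (2 · c · u² · S⁻ · k) = Ω(W) · ĥ(P)`,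

`u = #𝓞_K^×/2`, `S⁻ = ∑_{a mod |d|} (a/|d|)[a/|d|]⁻_f ∈ ℚ`, `k = c·Ω⁻_f/|Ω⁻(W)|` (an integer `≠ 0`,
`exists_int_maninConstant_mul_minusPeriod_eq`), `Ω(W) = realPeriodRat`, `ĥ` the canonical height on
`E(ℚ)`. Proof: `L'(E,1)L(E^{(d)},1) = (Ω|Ω⁻|/(c²u²√|d|))ĥ_K(P_K)` (product rule, `hGZF`,
`Ω|Ω⁻| = 2covol`), `√|d|L(E^{(d)},1) = S⁻Ω⁻_f` (Birch), `ĥ(P) = 2ĥ_K(P_K)` (Darmon 3.11 + base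
change); if `L(E^{(d)},1) = 0` both sides vanish. [cite: GrossZagier1986, Thm. I.(7.3) (p. 231), V.(2.1)–(2.3), V.§2 (pp. 312–313)]
[cite: Darmon2004, Prop. 3.11] -/
theorem deriv_entireLFunction_one_mul_eq_of_heegnerPoint (hE : hasEntireLFunction_rat)
    (W : WeierstrassCurve ℚ) [W.IsElliptic] [W.IsGloballyMinimal] [NeZero (W.conductorNorm ℤ)]
    (h0 : W.entireLFunction 1 = 0) (hw : W.rootNumber = -1)
    (K : Type) [Field K] [NumberField K] (hK : IsImaginaryQuadratic K)
    (hH : SatisfiesHeegnerHypothesis (W.conductorNorm ℤ) K) (hodd : Odd (NumberField.discr K))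
    (hGZF : GrossZagierFormula (W.conductorNorm ℤ) W K)
    (Dt : ModularParametrizationData W (W.conductorNorm ℤ))
    (Hd : HeegnerDatum (W.conductorNorm ℤ) (NumberField.discr K)) (ι : K →+* ℂ)
    (PK : (W.baseChange K).toAffine.Point)
    (hι : WeierstrassCurve.Affine.Point.map ι.toRatAlgHom PK = heegnerPointComplex Dt Hd)
    {σ : K →ₐ[ℚ] K} (hσ : σ ≠ AlgHom.id ℚ K) (R : W.toAffine.Point)
    (hR : incl K W R = PK + conjMap W σ PK) [NeZero (NumberField.discr K).natAbs] :
    deriv W.entireLFunction 1 *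
        ((2 * (Dt.c : ℝ) * ((Units.torsionOrder K : ℝ) / 2) ^ 2 *
          ((∑ a : ZMod (NumberField.discr K).natAbs,
              (J((a.val : ℤ) | (NumberField.discr K).natAbs) : ℚ) *
                ratMinusSymbol Dt.f ((a.val : ℚ) / (NumberField.discr K).natAbs) : ℚ) : ℝ) *
          ((Dt.c : ℝ) * minusPeriod Dt.f / W.imaginaryPeriodRat) : ℝ) : ℂ) =
      ((W.realPeriodRat * canonicalHeight R : ℝ) : ℂ) := by
  set S : ℚ := ∑ a : ZMod (NumberField.discr K).natAbs,
    (J((a.val : ℤ) | (NumberField.discr K).natAbs) : ℚ) *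
      ratMinusSymbol Dt.f ((a.val : ℚ) / (NumberField.discr K).natAbs) with hS
  have hdneg : (NumberField.discr K) < 0 := IsImaginaryQuadratic.discr_neg hK
  have hd4sq : (NumberField.discr K) % 4 = 1 ∧ Squarefree (NumberField.discr K) := by
    rcases QuadraticFields.Quadratic.isFundamentalDiscriminant_discr hK.1 with ⟨h4, hsq, -⟩ | ⟨h4, -, -⟩
    · exact ⟨h4, hsq⟩
    · exfalso
      exact (Int.not_even_iff_odd.mpr hodd) (even_iff_two_dvd.mpr (dvd_trans ⟨2, by norm_num⟩ h4))
  have hkr := (satisfiesHeegnerHypothesis_iff_kronecker (W.conductorNorm ℤ) K hK.1).mp hH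
  have hgcd : Int.gcd (NumberField.discr K) (W.conductorNorm ℤ) = 1 :=
    int_gcd_eq_one_of_forall_jacobiSym_eq_one (by omega) fun p hp hpN hp2 ↦ (hkr p hp hpN).2 hp2
  have hdq : ((NumberField.discr K) : ℚ) ≠ 0 := by exact_mod_cast hdneg.ne
  haveI := W.isElliptic_quadraticTwist hdq
  -- Gross–Zagier, product rule, Birch, periods, heights
  have eGZ := hGZF Dt Hd ι PK hι
  have hprod := lDerivEK_eq_deriv_mul_of_entireLFunction_one_eq_zero hE W K h0
  have hs := sqrt_mul_entireLFunction_quadraticTwist_one_eq_symbolSum_mul_minusPeriod hE W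
    Dt.isNewformOf hdneg hd4sq.2 hd4sq.1 hgcd
  rw [← hS] at hs
  have hcov := Dt.realPeriodRat_mul_imaginaryPeriodRat_eq_two_mul_covolume
  have hT := heegnerPoint_conj_add_rootNumber_smul_holds W K hK hH ⟨Dt, Hd, ι, hι⟩ σ hσ
  rw [hw, neg_one_zsmul, ← sub_eq_add_neg] at hT
  have hhR : canonicalHeight R = 2 * canonicalHeight PK :=
    canonicalHeight_eq_two_mul_of_incl_eq W hK.1 σ hT hR
  -- non-vanishing bookkeeping
  have hc : (Dt.c : ℝ) ≠ 0 := Int.cast_ne_zero.mpr Dt.maninConstant_ne_zero_holds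
  have hu : (0 : ℝ) < Units.torsionOrder K := by exact_mod_cast Units.torsionOrder_pos K
  have hsD : 0 < Real.sqrt |((NumberField.discr K) : ℝ)| :=
    Real.sqrt_pos.mpr (abs_pos.mpr (by exact_mod_cast hdneg.ne))
  have hΩm : 0 < W.imaginaryPeriodRat := W.imaginaryPeriodRat_pos
  have hΩf : 0 < minusPeriod Dt.f :=
    IsNewform0.minusPeriod_pos_holds Dt.isNewformOf.1 Dt.isNewformOf.coeffField_eq_bot
  have hcov' : ZLattice.covolume Dt.L.lattice = W.realPeriodRat * W.imaginaryPeriodRat / 2 := by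
    linarith [hcov]
  by_cases hLt : (W.quadraticTwist ((NumberField.discr K) : ℚ)).entireLFunction 1 = 0
  · -- both sides vanish: `S = 0` and `ĥ_K(P_K) = 0`
    have hS0 : (S : ℝ) = 0 := by
      rw [hLt, mul_zero] at hs
      have h := (mul_eq_zero.mp hs.symm).resolve_right (Complex.ofReal_ne_zero.mpr hΩf.ne')
      exact_mod_cast h
    have hLD : LDerivEK W K = 0 := by rw [hprod, hLt, mul_zero]
    have hP0 : canonicalHeight PK = 0 := by
      rw [hLD] at eGZ
      have h := (Complex.ofReal_eq_zero.mp eGZ.symm)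
      rcases mul_eq_zero.mp h with h | h
      · exfalso
        have : 0 < 2 * ZLattice.covolume Dt.L.lattice /
            ((Dt.c : ℝ) ^ 2 * ((Units.torsionOrder K : ℝ) / 2) ^ 2 * Real.sqrt |((NumberField.discr K) : ℝ)|) := by
          have hcv : 0 < ZLattice.covolume Dt.L.lattice := ZLattice.covolume_pos _ _
          positivity
        exact this.ne' h
      · exact h
    rw [hhR, hP0, hS0]
    simp
  · have hS0 : (S : ℝ) ≠ 0 := by
      intro hS0
      apply hLt
      have : (S : ℂ) = 0 := by exact_mod_cast hS0
      rw [this, zero_mul, mul_eq_zero] at hs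
      exact hs.resolve_left (Complex.ofReal_ne_zero.mpr hsD.ne')
    have hLd : (W.quadraticTwist ((NumberField.discr K) : ℚ)).entireLFunction 1 =
        (((S : ℝ) * minusPeriod Dt.f / Real.sqrt |((NumberField.discr K) : ℝ)| : ℝ) : ℂ) := by
      have hsDC : (Real.sqrt |((NumberField.discr K) : ℝ)| : ℂ) ≠ 0 := Complex.ofReal_ne_zero.mpr hsD.ne'
      rw [Complex.ofReal_div, eq_div_iff hsDC]
      push_cast
      linear_combination hs
    have hL' : deriv W.entireLFunction 1 =
        (((2 * ZLattice.covolume Dt.L.lattice /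
            ((Dt.c : ℝ) ^ 2 * ((Units.torsionOrder K : ℝ) / 2) ^ 2 * Real.sqrt |((NumberField.discr K) : ℝ)|) *
            canonicalHeight PK) / ((S : ℝ) * minusPeriod Dt.f / Real.sqrt |((NumberField.discr K) : ℝ)|) : ℝ) : ℂ) := by
      rw [Complex.ofReal_div, ← hLd, ← eGZ, hprod, mul_div_cancel_right₀ _ hLt]
    rw [hL', ← Complex.ofReal_mul, Complex.ofReal_inj, hhR, hcov']
    field_simp

/-- **The same, solved for `L'(E,1)` when `L(E^{(d_K)},1) ≠ 0`** (the field of Waldspurger /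
Hoffstein–Luo): `L'(E,1) = Ω(W)·ĥ(P)/(2·c·u²·S⁻·k)` — Gross–Zagier's Thm. I.(7.3) with its `α ∈ ℚ^×`
written out (`S⁻ ≠ 0` by Birch's formula, `k ∈ ℤ ∖ {0}`). [cite: GrossZagier1986, Thm. I.(7.3) (p. 231); V.§2 (pp. 312–313)] -/
theorem deriv_entireLFunction_one_eq_div_of_heegnerPoint (hE : hasEntireLFunction_rat)
    (W : WeierstrassCurve ℚ) [W.IsElliptic] [W.IsGloballyMinimal] [NeZero (W.conductorNorm ℤ)]
    (h0 : W.entireLFunction 1 = 0) (hw : W.rootNumber = -1)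
    (K : Type) [Field K] [NumberField K] (hK : IsImaginaryQuadratic K)
    (hH : SatisfiesHeegnerHypothesis (W.conductorNorm ℤ) K) (hodd : Odd (NumberField.discr K))
    (hLt : (W.quadraticTwist (NumberField.discr K : ℚ)).entireLFunction 1 ≠ 0)
    (hGZF : GrossZagierFormula (W.conductorNorm ℤ) W K)
    (Dt : ModularParametrizationData W (W.conductorNorm ℤ))
    (Hd : HeegnerDatum (W.conductorNorm ℤ) (NumberField.discr K)) (ι : K →+* ℂ)
    (PK : (W.baseChange K).toAffine.Point)
    (hι : WeierstrassCurve.Affine.Point.map ι.toRatAlgHom PK = heegnerPointComplex Dt Hd)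
    {σ : K →ₐ[ℚ] K} (hσ : σ ≠ AlgHom.id ℚ K) (R : W.toAffine.Point)
    (hR : incl K W R = PK + conjMap W σ PK) [NeZero (NumberField.discr K).natAbs] :
    deriv W.entireLFunction 1 =
      ((W.realPeriodRat * canonicalHeight R /
        (2 * (Dt.c : ℝ) * ((Units.torsionOrder K : ℝ) / 2) ^ 2 *
          ((∑ a : ZMod (NumberField.discr K).natAbs,
              (J((a.val : ℤ) | (NumberField.discr K).natAbs) : ℚ) *
                ratMinusSymbol Dt.f ((a.val : ℚ) / (NumberField.discr K).natAbs) : ℚ) : ℝ) *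
          ((Dt.c : ℝ) * minusPeriod Dt.f / W.imaginaryPeriodRat)) : ℝ) : ℂ) := by
  have h := deriv_entireLFunction_one_mul_eq_of_heegnerPoint hE W h0 hw K hK hH hodd hGZF Dt Hd ι
    PK hι hσ R hR
  set S : ℚ := ∑ a : ZMod (NumberField.discr K).natAbs,
    (J((a.val : ℤ) | (NumberField.discr K).natAbs) : ℚ) *
      ratMinusSymbol Dt.f ((a.val : ℚ) / (NumberField.discr K).natAbs) with hS
  have hdneg : (NumberField.discr K) < 0 := IsImaginaryQuadratic.discr_neg hK
  -- the factor is non-zero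
  have hc : (Dt.c : ℝ) ≠ 0 := Int.cast_ne_zero.mpr Dt.maninConstant_ne_zero_holds
  have hu : (Units.torsionOrder K : ℝ) / 2 ≠ 0 :=
    div_ne_zero (by exact_mod_cast (Units.torsionOrder_pos K).ne') two_ne_zero
  have hΩm : 0 < W.imaginaryPeriodRat := W.imaginaryPeriodRat_pos
  have hΩf : 0 < minusPeriod Dt.f :=
    IsNewform0.minusPeriod_pos_holds Dt.isNewformOf.1 Dt.isNewformOf.coeffField_eq_bot
  have hS0 : (S : ℝ) ≠ 0 := by
    intro hS0
    have hd4sq : (NumberField.discr K) % 4 = 1 ∧ Squarefree (NumberField.discr K) := by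
      rcases QuadraticFields.Quadratic.isFundamentalDiscriminant_discr hK.1 with
        ⟨h4, hsq, -⟩ | ⟨h4, -, -⟩
      · exact ⟨h4, hsq⟩
      · exfalso
        exact (Int.not_even_iff_odd.mpr hodd) (even_iff_two_dvd.mpr (dvd_trans ⟨2, by norm_num⟩ h4))
    have hkr := (satisfiesHeegnerHypothesis_iff_kronecker (W.conductorNorm ℤ) K hK.1).mp hH
    have hgcd : Int.gcd (NumberField.discr K) (W.conductorNorm ℤ) = 1 :=
      int_gcd_eq_one_of_forall_jacobiSym_eq_one (by omega) fun p hp hpN hp2 ↦ (hkr p hp hpN).2 hp2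
    have hs := sqrt_mul_entireLFunction_quadraticTwist_one_eq_symbolSum_mul_minusPeriod hE W
      Dt.isNewformOf hdneg hd4sq.2 hd4sq.1 hgcd
    rw [← hS] at hs
    have hsD : 0 < Real.sqrt |((NumberField.discr K) : ℝ)| :=
      Real.sqrt_pos.mpr (abs_pos.mpr (by exact_mod_cast hdneg.ne))
    have : (S : ℂ) = 0 := by exact_mod_cast hS0
    rw [this, zero_mul, mul_eq_zero] at hs
    exact hLt (hs.resolve_left (Complex.ofReal_ne_zero.mpr hsD.ne'))
  have hF : (2 * (Dt.c : ℝ) * ((Units.torsionOrder K : ℝ) / 2) ^ 2 * (S : ℝ) *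
      ((Dt.c : ℝ) * minusPeriod Dt.f / W.imaginaryPeriodRat)) ≠ 0 := by
    have : (Dt.c : ℝ) * minusPeriod Dt.f / W.imaginaryPeriodRat ≠ 0 :=
      div_ne_zero (mul_ne_zero hc hΩf.ne') hΩm.ne'
    exact mul_ne_zero (mul_ne_zero (mul_ne_zero (mul_ne_zero two_ne_zero hc) (pow_ne_zero 2 hu)) hS0)
      this
  rw [Complex.ofReal_div, eq_div_iff (Complex.ofReal_ne_zero.mpr hF)]
  exact h

end Literature.NumberTheory.EllipticCurves

end
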